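import Literature.AnabelianGeometry.SemiGraphs.SubgraphComponentsDoubleCosetsOfClosedCells
import HarnessLib

/-!
# (D3) `covering_subgraphComponents_doubleCosets` WITHOUT branch alignment over every connected `𝒢` whose closed branches are Π-ESSENTIAL ([SemiAnbd] Cor. 2.7 (i) p. 30)

Mochizuki, *Semi-graphs of anabelioids*, Publ. RIMS **42** (2006), §2, proof of Cor. 2.7 (i) p. 30
("[as one verifies immediately] `ℋ′` injects into `𝒢′` as a subgraph") [cite: MochizukiSemiAnbd2006, Cor. 2.7(i) p.30];
Def. 2.2 (i) p. 23, Rem. 2.2.1 p. 24 (decomposition groups).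

PROOF-ONLY (abc-iut cell, layer L3; FACT-LIST row F-1487 `covering_subgraphComponents_doubleCosets`
AS TYPED — local ∧ global ∧ vertex-aligned, NO branch alignment —, CLASS route «regluing invisibility»
of abc-iut-w4-d080, brick R6 corollary E3 «a class of BASES»; seat abc-iut-f-161 (gen 13)).  The
closers E1/E2d ask, cell by cell of `𝔾_A`, for non-separation or bi-essentiality.  This file removes
`A` from the hypothesis: a condition on the semi-graph of anabelioids `𝒢` ALONE.

* `BObj.exists_point_over_cell` — a fibre point over any edge-cell, in the identity frame;
* `covering_subgraphComponents_doubleCosets_of_essentialBranches` — TOKEN (abc-iut-L3-lead ζ17,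
  verbatim): «(D3) AS TYPED for EVERY `A ∈ B(𝒢)` and every covering attached to `A`, over every
  connected `𝒢` each of whose CLOSED-edge branches is Π-ESSENTIAL — no open subgroup of `Π_v` maps
  into the edge group `D_b`, read in `Π_𝒢` — a condition on `𝒢` ALONE; residual = a closed-edge branch
  whose edge group is open in (the image of) its vertex group (HAIR) = R7, untouched».  Proof: every
  closed edge-cell `(e, Q)` of `𝔾_A` is essential on both sides at the OPEN stabiliser
  (Mathlib `stabilizer_isOpen`, `Mathlib.Topology.Algebra.MulAction`) of a point over `Q` in the
  identity frames, so E2d `covering_subgraphComponents_doubleCosets_of_closedEssentialCells` applies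
  with the (ESS) disjunct everywhere.

HONEST SCOPE.  (a) The class condition forces `Π_v → Π_𝒢` to have INFINITE image at every vertex
carrying a closed-edge branch (take `U` = any open subgroup, e.g. `U = ⊥` when `Π_v` is finite: then
`u = 1` maps into `D_b`); in particular semi-graphs of anabelioids with FINITE or trivial vertex
anabelioids at closed edges — e.g. plain finite graphs — are OUTSIDE the class.  (b) «The situation of
pointed stable curves» (`Π_e ≅ Ẑ(1)` inside an infinite `Π_v`) is MOTIVATION only: no claim is made
here that any particular `𝒢` of the IUT papers satisfies the binder (that would be a separate, typed
instance statement).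

CLASS-route closer: F-1487 AS TYPED (all `𝒢`, including HAIR sides — edge groups open in vertex
groups) stays OPEN-AS-TYPED (L3-lead δ22); CLASS CLOSER ≠ the fact; typed ≠ proved; no definition,
no instance, no new named fact; nothing here takes a side on [IUTchIII] Cor. 3.12.
-/

namespace Literature.AnabelianGeometry.SemiGraphs

namespace SemiGraphOfAnabelioids

open CategoryTheory CategoryTheory.Limits CategoryTheory.Functor CategoryTheory.PreGaloisCategory
open Literature.AnabelianGeometry.Anabelioids
open scoped Pointwise

universe v₁ u₁ u

variable {𝒢 𝒢' : SemiGraphOfAnabelioids.{v₁, u₁, u}}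

/-- **A point over a cell, in the identity frame**: every edge-cell `Q ⊆ A_e` has, on the side of a
branch `b ∋ v` of `e`, a point of `F(A_v)` lying over it, for the basepoint `F := b^* ⋙ F_e`
(the image under `ψ_b⁻¹` of a fibre point of `Q`). [cite: MochizukiSemiAnbd2006, Def. 2.2(i) p.23] -/
theorem BObj.exists_point_over_cell (A : 𝒢.BObj) (b : 𝒢.graph.Branch) (v : 𝒢.graph.Vertex)
    (h : 𝒢.graph.abuts b = some v) (Fe : 𝒢.E (𝒢.graph.edgeOf b) ⥤ FintypeCat.{v₁}) [FiberFunctor Fe]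
    (Q : π₀Obj (A.T (𝒢.graph.edgeOf b))) :
    ∃ a : ((𝒢.pull b v h).pullback ⋙ Fe).obj (A.S v),
      Fe.map (A.ψ b v h).hom ((Iso.refl ((𝒢.pull b v h).pullback ⋙ Fe)).inv.app (A.S v) a) ∈
        Set.range (Fe.map Q.1.arrow) := by
  haveI := Q.2
  obtain ⟨q⟩ := nonempty_fiber_of_isConnected Fe (Q.1 : 𝒢.E (𝒢.graph.edgeOf b))
  refine ⟨Fe.map (A.ψ b v h).inv (Fe.map Q.1.arrow q), q, ?_⟩
  change Fe.map Q.1.arrow q = Fe.map (A.ψ b v h).hom (Fe.map (A.ψ b v h).inv (Fe.map Q.1.arrow q))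
  rw [← FintypeCat.comp_apply (Fe.map (A.ψ b v h).inv), ← Fe.map_comp, Iso.inv_hom_id, Fe.map_id,
    FintypeCat.id_apply]

/-- **(D3) AS TYPED over every connected `𝒢` whose closed-edge branches are Π-ESSENTIAL** — TOKEN
(abc-iut-L3-lead ζ17): «(D3) AS TYPED for EVERY `A ∈ B(𝒢)` and every covering attached to `A`, over
every connected `𝒢` each of whose CLOSED-edge branches is Π-ESSENTIAL — no open subgroup of `Π_v` maps
into the edge group `D_b`, read in `Π_𝒢` — a condition on `𝒢` ALONE; residual = a closed-edge branch
whose edge group is open in (the image of) its vertex group (HAIR) = R7, untouched» ([SemiAnbd]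
Cor. 2.7 (i) p. 30, "`ℋ′` injects into `𝒢′` as a subgraph"; Def. 2.2 (i) p. 23 at the TYPED notion
of morphism: local ∧ global ∧ vertex-aligned, NO branch alignment).  Let `𝒢` be connected and assume:
for every branch `b ∋ v` whose edge is CLOSED, every frame `(F, F_e, α)` and every OPEN subgroup
`U ≤ Π_v = Aut F`, some `u ∈ U` does not map into the edge group `D_b = α(Π_b) ≤ Π` (no open
subgroup of the vertex group lies in the edge decomposition group).  Then for EVERY `A ∈ B(𝒢)`, every
`φ : 𝒢′ → 𝒢` from a connected `𝒢′` which is locally and globally the covering attached to `A` and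
vertex-aligned satisfies the body of `covering_subgraphComponents_doubleCosets` ((P1) preimage
components of `ℍ` ↔ `Π_ℍ \ Π_𝒢 / Π′`, (P2) the component through `v′` exists, (P3) it goes to the
class of `Π′` with `ι(Π_{K₀}) = Π′ ∩ Π_ℍ`, (P4) `ι(Π_K) = Π′ ∩ g⁻¹ Π_ℍ g`).  Proof: for a closed edge-cell
`(e, Q)`, `e = {b₀, b₁}`, take the identity frames `F₁ := b₀^* ⋙ F_e`, `F₂ := b₁^* ⋙ F_e′`, points
`a₁`, `a₂` over `Q` (`BObj.exists_point_over_cell`) and apply the hypothesis to the OPEN stabilisers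
`Stab(a₁)`, `Stab(a₂)` (Mathlib `stabilizer_isOpen`, continuous action of `Aut F` on the discrete
fibre): the cell is essential on both sides; then E2d
`covering_subgraphComponents_doubleCosets_of_closedEssentialCells`.  CLASS CLOSER only (bases with a
HAIR side, and bases with finite vertex anabelioids at closed edges, are outside the class): the typed
fact, which quantifies over all `𝒢`, is not asserted. [cite: MochizukiSemiAnbd2006, Cor. 2.7(i) p.30] -/
theorem covering_subgraphComponents_doubleCosets_of_essentialBranches :
    ∀ (𝒢 𝒢' : SemiGraphOfAnabelioids.{v₁, u₁, u}) (φ : Hom 𝒢' 𝒢) (A : 𝒢.BObj),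
      𝒢.IsConnected → 𝒢'.IsConnected → φ.IsFiniteEtaleCoveringOf A → φ.IsGlobalCoveringOf A →
      φ.IsVertexAligned →
      (∀ (v : 𝒢.graph.Vertex) (F : 𝒢.V v ⥤ FintypeCat.{v₁}) [FiberFunctor F]
          (b : 𝒢.graph.Branch) (h : 𝒢.graph.abuts b = some v),
          (∀ b' : 𝒢.graph.Branch, 𝒢.graph.edgeOf b' = 𝒢.graph.edgeOf b → (𝒢.graph.abuts b').isSome) →
          ∀ (Fe : 𝒢.E (𝒢.graph.edgeOf b) ⥤ FintypeCat.{v₁}) [FiberFunctor Fe]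
            (α : (𝒢.pull b v h).pullback ⋙ Fe ≅ F) (U : Subgroup (𝒢.PiV v F)),
            IsOpen (U : Set (𝒢.PiV v F)) →
            ∃ u ∈ U, 𝒢.piVToPi v F u ∉ (𝒢.branchSubgroup F b h Fe α).map (𝒢.piVToPi v F)) →
      ∀ (v' : 𝒢'.graph.Vertex) (F' : 𝒢'.V v' ⥤ FintypeCat.{v₁}) [FiberFunctor F']
        (F : 𝒢.V (φ.base.vertexMap v') ⥤ FintypeCat.{v₁}) [FiberFunctor F]
        (e : (φ.φV v').pullback ⋙ F' ≅ F)
        (H : 𝒢.graph.Subgraph), H.toSemiGraph.IsConnected → H.toSemiGraph.IsGraph →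
        ∀ (hv : φ.base.vertexMap v' ∈ H.verts),
        let v := φ.base.vertexMap v'
        let ι : 𝒢'.Pi v' F' →* 𝒢.Pi v F :=
          (Aut.autMulEquivOfIso (Functor.isoWhiskerLeft (𝒢.ρ v) e)).toMonoidHom.comp
            (pi1Map φ.pullbackFunctor (𝒢'.ρ v' ⋙ F'))
        let PH : Subgroup (𝒢.Pi v F) := (𝒢.piHToPi H ⟨v, hv⟩ F).range
        ∀ x₀ : (𝒢.ρ v ⋙ F).obj A, ι.range = MulAction.stabilizer (𝒢.Pi v F) x₀ →
          ∃ d : {K : 𝒢'.graph.Subgraph // φ.IsPreimageComponent H K} → 𝒢.Pi v F,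
            Function.Bijective (fun K => DoubleCoset.mk PH ι.range (d K)) ∧
            (∃ K₀ : {K : 𝒢'.graph.Subgraph // φ.IsPreimageComponent H K}, v' ∈ K₀.1.verts) ∧
            (∀ (K : {K : 𝒢'.graph.Subgraph // φ.IsPreimageComponent H K}) (hK : v' ∈ K.1.verts),
              d K ∈ ι.range ∧ (ι.comp (𝒢'.piHToPi K.1 ⟨v', hK⟩ F')).range = ι.range ⊓ PH) ∧
            ∀ (K : {K : 𝒢'.graph.Subgraph // φ.IsPreimageComponent H K})
              (w'' : K.1.toSemiGraph.Vertex) (F'' : 𝒢'.V w''.1 ⥤ FintypeCat.{v₁}) [FiberFunctor F'']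
              (α : 𝒢'.ρ w''.1 ⋙ F'' ≅ 𝒢'.ρ v' ⋙ F'),
              ∃ g : 𝒢.Pi v F,
                (ι.comp ((Aut.autMulEquivOfIso α).toMonoidHom.comp (𝒢'.piHToPi K.1 w'' F''))).range =
                  ι.range ⊓ ConjAct.toConjAct g⁻¹ • PH := by
  intro 𝒢 𝒢' φ A h𝒢 h𝒢' hloc hB hva hbr
  refine covering_subgraphComponents_doubleCosets_of_closedEssentialCells 𝒢 𝒢' φ A h𝒢 h𝒢' hloc hB
    hva ?_
  intro e hcl Q
  refine Or.inr ?_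
  classical
  -- the two branches of the closed edge `e` and their ends
  obtain ⟨b₀, b₁, hne, hb₀, hb₁, -⟩ := 𝒢.graph.two_branches e
  subst hb₀
  obtain ⟨v₁, h₀⟩ := Option.isSome_iff_exists.mp (hcl b₀ rfl)
  obtain ⟨v₂, h₁⟩ := Option.isSome_iff_exists.mp (hcl b₁ hb₁)
  -- identity frames on both sides
  let Fe := GaloisCategory.getFiberFunctor (𝒢.E (𝒢.graph.edgeOf b₀))
  let F₁ : 𝒢.V v₁ ⥤ FintypeCat.{v₁} := (𝒢.pull b₀ v₁ h₀).pullback ⋙ Fe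
  haveI : FiberFunctor F₁ := fiberFunctor_comp_of_exact _ Fe
  let Fe' := GaloisCategory.getFiberFunctor (𝒢.E (𝒢.graph.edgeOf b₁))
  let F₂ : 𝒢.V v₂ ⥤ FintypeCat.{v₁} := (𝒢.pull b₁ v₂ h₁).pullback ⋙ Fe'
  haveI : FiberFunctor F₂ := fiberFunctor_comp_of_exact _ Fe'
  -- the cell named over the other branch
  obtain ⟨Q₁, hQ₁⟩ : ∃ Q₁ : π₀Obj (A.T (𝒢.graph.edgeOf b₁)),
      (⟨𝒢.graph.edgeOf b₁, Q₁⟩ : Σ e, π₀Obj (A.T e)) = ⟨𝒢.graph.edgeOf b₀, Q⟩ := by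
    rw [hb₁]
    exact ⟨Q, rfl⟩
  -- points over the cell on both sides, and the open stabilisers
  obtain ⟨a₁, ha₁⟩ := A.exists_point_over_cell b₀ v₁ h₀ Fe Q
  obtain ⟨a₂, ha₂⟩ := A.exists_point_over_cell b₁ v₂ h₁ Fe' Q₁
  obtain ⟨u₁, hu₁, hn₁⟩ := hbr v₁ F₁ b₀ h₀ hcl Fe (Iso.refl _)
    (MulAction.stabilizer (𝒢.PiV v₁ F₁) a₁) (stabilizer_isOpen (𝒢.PiV v₁ F₁) a₁)
  obtain ⟨u₂, hu₂, hn₂⟩ := hbr v₂ F₂ b₁ h₁ (fun b' hb' => hcl b' (hb'.trans hb₁)) Fe' (Iso.refl _)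
    (MulAction.stabilizer (𝒢.PiV v₂ F₂) a₂) (stabilizer_isOpen (𝒢.PiV v₂ F₂) a₂)
  exact ⟨v₁, F₁, inferInstance, b₀, h₀, Fe, inferInstance, Iso.refl _, Q, rfl, a₁, ha₁,
    ⟨u₁, MulAction.mem_stabilizer_iff.mp hu₁, hn₁⟩, v₂, F₂, inferInstance, b₁, hne.symm, h₁, Fe',
    inferInstance, Iso.refl _, Q₁, hQ₁, a₂, ha₂, ⟨u₂, MulAction.mem_stabilizer_iff.mp hu₂, hn₂⟩⟩

end SemiGraphOfAnabelioids

end Literature.AnabelianGeometry.SemiGraphs
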